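import Mathlib
import Summits.ValiantsHypothesis.ValiantsHypothesis.Theses.ElementaryWordLength
import Summits.ValiantsHypothesis.ValiantsHypothesis.Theorems.ElementaryWordLengthWordPerSuperQuarticStubSquareZeroFactor
import Summits.ValiantsHypothesis.ValiantsHypothesis.Theorems.ElementaryWordLengthWordPerSuperQuarticStubPairCompletion
import Summits.ValiantsHypothesis.ValiantsHypothesis.Theorems.ElementaryWordLengthWordPerSuperQuarticStubChainToWord
import Summits.ValiantsHypothesis.ValiantsHypothesis.Theorems.ElementaryWordLengthWordPerSuperQuarticStubConverseArith

/-!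
# Crux `ElementaryWordLength.WordPerSuperQuartic` (stmt-ValiantsHypothesis-6624), line `Sketch`:
# **chains are words** and **the crux ⇒ pattern chain hardness** (the converse of the glue)

The chain normal form (`stub_chainNormalForm`, p108980) turns an affine elementary word into a chain
`Π_t (1 + x_{v_t}·N_t)` of constant square-zero `3 × 3` matrices with one factor per variable letter.
This file proves the converse dictionary row and uses it to show that the open stub of line `Sketch` is
not stronger than the crux:

* `chain_to_word` — a chain of square-zero matrices of length `m` is the matrix of an affine elementary
  word of length `≤ 25·m` with off-diagonal letters, at most `m` of them variable letters, reading only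
  the chain's variables.  (A square-zero `N ≠ 0` is `u wᵀ` with `wᵀu = 0` — `stub_squareZeroFactor`,
  p116340; some product `g` of `≤ 12` constant transvections has `g e₀ = u`, `wᵀ g = e₂ᵀ` —
  `stub_pairCompletion`, p116632; then `1 + x·u wᵀ = g · E_02(x) · g⁻¹` — `stub_chainToWord`, p116684.)
  In particular a short CHAIN for `E_02(per_n)` is a short WORD: chain constructions refute word
  statements directly.
* `patternChainHardness_of_wordPerSuperQuartic : WordPerSuperQuartic → S1b'` (pattern chain hardness,
  the open stub of line `Sketch` since cycle 5), with `S = univ`, `ε ↦ ε/2` (`stub_converseArith`,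
  p116332).  Together with `wordPerSuperQuartic_of_patternChainHardness`
  (`Theorems/ElementaryWordLengthWordPerSuperQuarticPatternGlue.lean`): **S1b' ⟺ the crux** — pattern
  restriction plus the chain normal form are a faithful normal form of the word model for `per_n`, no
  more and no less (`Theorems/ElementaryWordLengthWordPerSuperQuarticPatternEquivalence.lean`).
References: Ben-Or–Cleve 1992 (the word model).
-/

noncomputable section

-- `Summit.ValiantsHypothesis.ValiantsHypothesis.…` is the tree's mandated single-conjunct layout.
set_option linter.dupNamespace false

namespace Summit.ValiantsHypothesis.ValiantsHypothesis.Theorems.WordPerSuperQuartic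

open Literature.Computability.AlgebraicComplexity MvPolynomial

/-! ## Chains are words -/

/-- **Chain → word.**  A chain `Π_t (1 + x_{v_t}·N_t)` of constant square-zero `3 × 3` matrices of length
`m` is the matrix of an affine elementary word of length `≤ 25·m` whose letters are off-diagonal, whose
variable letters read only variables of the chain and number at most `m`. [folklore] -/
theorem chain_to_word {σ : Type} [DecidableEq σ] (L : List (σ × Matrix (Fin 3) (Fin 3) ℂ))
    (hN : ∀ e ∈ L, e.2 * e.2 = 0) :
    ∃ w : List (Fin 3 × Fin 3 × ℂ × Option σ), w.length ≤ 25 * L.length ∧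
      (∀ l ∈ w, l.1 ≠ l.2.1) ∧ (∀ l ∈ w, ∀ v, l.2.2.2 = some v → v ∈ L.map Prod.fst) ∧
      w.countP (fun l => l.2.2.2.isSome) ≤ L.length ∧
      (w.map (fun l => Matrix.transvection l.1 l.2.1
          (MvPolynomial.C l.2.2.1 * l.2.2.2.elim 1 MvPolynomial.X : MvPolynomial σ ℂ))).prod =
        (L.map (fun e => (1 : Matrix (Fin 3) (Fin 3) (MvPolynomial σ ℂ)) +
          (MvPolynomial.X e.1 : MvPolynomial σ ℂ) •
            e.2.map (MvPolynomial.C : ℂ → MvPolynomial σ ℂ))).prod :=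
  stub_chainToWord 12 stub_squareZeroFactor stub_pairCompletion L hN

/-! ## The crux implies pattern chain hardness -/

/-- The generic permanent has zero constant term (`n ≥ 1`). -/
theorem constantCoeff_perPoly (n : ℕ) (hn : 1 ≤ n) :
    MvPolynomial.constantCoeff (perPoly (Fin n) ℂ) = 0 := by
  have hh : (perPoly (Fin n) ℂ).IsHomogeneous (Fintype.card (Fin n)) := perPoly_isHomogeneous
  rw [MvPolynomial.constantCoeff_eq]
  apply hh.coeff_eq_zero
  simp only [map_zero, Fintype.card_fin]
  omega

/-- **`WordPerSuperQuartic` ⇒ pattern chain hardness (S1b')**, with the full pattern `S = univ` and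
`ε/2`: a chain of length `m` for `E_02(per_n)` is the matrix of a word of length `≤ 25·m`
(`chain_to_word`), so the crux gives `n^(4+ε) ≤ 25·m`, whence `|S|·n^(2+ε/2) = n²·n^(2+ε/2) < m` for
large `n` (`stub_converseArith`).  With `wordPerSuperQuartic_of_patternChainHardness`
(`Theorems/…PatternGlue.lean`) this makes S1b' EQUIVALENT to the crux. [folklore] -/
theorem patternChainHardness_of_wordPerSuperQuartic :
    Summit.ValiantsHypothesis.ValiantsHypothesis.Theses.ElementaryWordLength.WordPerSuperQuartic →
    ∃ ε : ℝ, 0 < ε ∧ ∃ n₀ : ℕ, ∀ n ≥ n₀, ∃ S : Finset (Fin n × Fin n), 0 < S.card ∧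
      ∃ x : Fin n × Fin n → ℂ, ∀ L : List ((Fin n × Fin n) × Matrix (Fin 3) (Fin 3) ℂ),
        (∀ e ∈ L, e.1 ∈ S) →
        (∀ e ∈ L, e.2 * e.2 = 0) →
        (L.map (fun e => (1 : Matrix (Fin 3) (Fin 3) (MvPolynomial (Fin n × Fin n) ℂ)) +
            (MvPolynomial.X e.1 : MvPolynomial (Fin n × Fin n) ℂ) •
              e.2.map (MvPolynomial.C : ℂ → MvPolynomial (Fin n × Fin n) ℂ))).prod =
          Matrix.transvection (0 : Fin 3) 2
            (MvPolynomial.aeval (fun v : Fin n × Fin n =>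
                if v ∈ S then MvPolynomial.X v else MvPolynomial.C (x v)) (perPoly (Fin n) ℂ) -
              MvPolynomial.C (MvPolynomial.constantCoeff (MvPolynomial.aeval (fun v : Fin n × Fin n =>
                if v ∈ S then MvPolynomial.X v else MvPolynomial.C (x v)) (perPoly (Fin n) ℂ)))) →
        (S.card : ℝ) * (n : ℝ) ^ (2 + ε) < (L.length : ℝ) := by
  intro h
  obtain ⟨ε, hε, n₀, hcrux⟩ := h
  obtain ⟨n₁, harith⟩ := stub_converseArith ε hε 25
  refine ⟨ε / 2, by positivity, max n₀ (max n₁ 1), fun n hn => ?_⟩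
  have hn₀ : n₀ ≤ n := le_trans (le_max_left _ _) hn
  have hn₁ : n₁ ≤ n := le_trans ((le_max_left _ _).trans (le_max_right _ _)) hn
  have hn1 : 1 ≤ n := le_trans ((le_max_right _ _).trans (le_max_right _ _)) hn
  have hcard : (Finset.univ : Finset (Fin n × Fin n)).card = n * n := by
    rw [Finset.card_univ, Fintype.card_prod, Fintype.card_fin]
  refine ⟨Finset.univ, ?_, fun _ => 0, fun L _ hN hprod => ?_⟩
  · rw [hcard]; exact Nat.mul_pos hn1 hn1
  -- the chain computes `E_02(per_n)` itself
  have hfun : (fun v : Fin n × Fin n =>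
      if v ∈ (Finset.univ : Finset (Fin n × Fin n)) then
        (MvPolynomial.X v : MvPolynomial (Fin n × Fin n) ℂ) else MvPolynomial.C ((fun _ => (0 : ℂ)) v)) =
      MvPolynomial.X := by
    funext v; simp
  rw [hfun, MvPolynomial.aeval_X_left_apply, constantCoeff_perPoly n hn1, map_zero, sub_zero] at hprod
  -- chain → word of length ≤ 25·|L|
  obtain ⟨w, hwlen, hwoff, -, -, hwprod⟩ := chain_to_word L hN
  rw [hprod] at hwprod
  -- the crux at `n`
  have hlen := hcrux n hn₀ w.length ⟨w, le_rfl, hwoff, hwprod⟩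
  have h25 : (n : ℝ) ^ (4 + ε) ≤ ((25 : ℕ) : ℝ) * (L.length : ℝ) := by
    have : (w.length : ℝ) ≤ ((25 : ℕ) : ℝ) * (L.length : ℝ) := by exact_mod_cast hwlen
    exact hlen.trans this
  have hlt := harith n hn₁ L.length h25
  rw [hcard]
  push_cast
  exact hlt

end Summit.ValiantsHypothesis.ValiantsHypothesis.Theorems.WordPerSuperQuartic

end
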